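import Summits.Ventures.PercRepro.MSTightTighteningSplit

/-!
# A partner member at the boundary of the trace forces a single partnerless member

Dossier proofs/MINE1-theoremS.md, Addendum 50 §1. For a family `F` and an element `r` write
`F₀ = part0 r F`, `F₁ = partr r F`, `K = partner r F`, `X = diffsX r F`, `Y = diffsY r F`.
If a partner member `k ∈ K` lies below every `r`-member (`k ⊆ t` for all `t ∈ F₁` — e.g. `k` is
the core `∩P` of the trace `P = proj r F`), then `t ↦ t ∖ k` is an injection of `F₁` into
`X ∩ Y` (`sdiff_mem_inter_of_mem_partr_of_mem_partner`): `|F₁| ≤ |X ∩ Y|`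
(`card_partr_le_card_inter_of_partner_subset`). At a **tightening direction of an excess-one
family** `|X ∩ Y| = |K| + 1` (`tight_proj_iff_card_edges`), so `|F₁| ≤ |K| + 1`: **at most one
partnerless `r`-member** (`card_partr_sdiff_part0_le_one_of_partner_subset`). The mirror: a
partner member above every `r`-free member (e.g. the top `∪P ∈ K`) forces at most one partnerless
`r`-free member (`card_part0_sdiff_partr_le_one_of_partner_superset`).

Consequences for the lane (Addendum 49 suppl. 1 (ii)): the census-exact failure pattern of L1
«`F₀` tight or `F₁` tight» — «`∩P ∈ K` or `∪P ∈ K`» — lives entirely in the singleton cases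
`|P₁| ≤ 1` / `|P₀| ≤ 1` of Conjecture (T) (p449345); the open shape (`|P₀|, |P₁| ≥ 2`) has no
partner member at the bottom or at the top of the trace
(`not_partner_subset_all_of_two_le`, `not_partner_superset_all_of_two_le`), so the boundary
hypotheses of (L1⁺) / (M0⁺) are automatic there.
-/

namespace PercRepro.MSTight

open Finset
open scoped FinsetFamily

variable {α : Type*} [DecidableEq α] {r : α} {F : Finset (Finset α)}

/-- A partner member `k` below every `r`-member: `t ↦ t ∖ k` injects `F₁` into `X ∩ Y`. -/
theorem card_partr_le_card_inter_of_partner_subset {k : Finset α} (hk : k ∈ partner r F)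
    (hkt : ∀ t ∈ partr r F, k ⊆ t) :
    (partr r F).card ≤ (diffsX r F ∩ diffsY r F).card := by
  have hinj : Set.InjOn (fun t : Finset α => t \ k) (partr r F : Set (Finset α)) := by
    intro t ht t' ht' h
    have h1 := hkt t ht
    have h2 := hkt t' ht'
    simp only at h
    rw [← sdiff_union_of_subset h1, ← sdiff_union_of_subset h2, h]
  calc (partr r F).card = ((partr r F).image fun t => t \ k).card :=
        (card_image_of_injOn hinj).symm
    _ ≤ (diffsX r F ∩ diffsY r F).card := by
        apply card_le_card
        intro E hE
        obtain ⟨t, ht, rfl⟩ := mem_image.1 hE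
        exact sdiff_mem_inter_of_mem_partr_of_mem_partner ht hk

/-- A partner member `k` above every `r`-free member: `p ↦ k ∖ p` injects `F₀` into `X ∩ Y`. -/
theorem card_part0_le_card_inter_of_partner_superset {k : Finset α} (hk : k ∈ partner r F)
    (hkp : ∀ p ∈ part0 r F, p ⊆ k) :
    (part0 r F).card ≤ (diffsX r F ∩ diffsY r F).card := by
  have hinj : Set.InjOn (fun p : Finset α => k \ p) (part0 r F : Set (Finset α)) := by
    intro p hp p' hp' h
    have h1 := hkp p hp
    have h2 := hkp p' hp'
    simp only at h
    rw [← Finset.sdiff_sdiff_eq_self h1, ← Finset.sdiff_sdiff_eq_self h2, h]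
  calc (part0 r F).card = ((part0 r F).image fun p => k \ p).card :=
        (card_image_of_injOn hinj).symm
    _ ≤ (diffsX r F ∩ diffsY r F).card := by
        apply card_le_card
        intro E hE
        obtain ⟨p, hp, rfl⟩ := mem_image.1 hE
        exact sdiff_mem_inter_of_mem_partner_of_mem_part0 hk hp

section Tightening

variable (hF : (F \\ F).card = F.card + 1) (hP : Tight (proj r F))
include hF hP

/-- **At a tightening direction of an excess-one family, a partner member below every
`r`-member leaves at most one partnerless `r`-member.** -/
theorem card_partr_sdiff_part0_le_one_of_partner_subset {k : Finset α} (hk : k ∈ partner r F)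
    (hkt : ∀ t ∈ partr r F, k ⊆ t) : (partr r F \ part0 r F).card ≤ 1 := by
  have h1 := card_partr_le_card_inter_of_partner_subset hk hkt
  have h2 := (tight_proj_iff_card_edges hF r).1 hP
  have h3 : (partr r F \ part0 r F).card + (partner r F).card = (partr r F).card := by
    rw [partner, inter_comm, card_sdiff_add_card_inter]
  omega

/-- **The mirror: a partner member above every `r`-free member leaves at most one partnerless
`r`-free member.** -/
theorem card_part0_sdiff_partr_le_one_of_partner_superset {k : Finset α} (hk : k ∈ partner r F)
    (hkp : ∀ p ∈ part0 r F, p ⊆ k) : (part0 r F \ partr r F).card ≤ 1 := by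
  have h1 := card_part0_le_card_inter_of_partner_superset hk hkp
  have h2 := (tight_proj_iff_card_edges hF r).1 hP
  have h3 : (part0 r F \ partr r F).card + (partner r F).card = (part0 r F).card := by
    rw [partner, card_sdiff_add_card_inter]
  omega

/-- In the open shape (`≥ 2` partnerless `r`-members) no partner member lies below every
`r`-member; in particular the core of the trace is not a partner member. -/
theorem not_partner_subset_all_of_two_le (h2 : 2 ≤ (partr r F \ part0 r F).card) :
    ¬ ∃ k ∈ partner r F, ∀ t ∈ partr r F, k ⊆ t := by
  rintro ⟨k, hk, hkt⟩
  have := card_partr_sdiff_part0_le_one_of_partner_subset hF hP hk hkt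
  omega

/-- In the open shape (`≥ 2` partnerless `r`-free members) no partner member lies above every
`r`-free member; in particular the top of the trace is not a partner member. -/
theorem not_partner_superset_all_of_two_le (h2 : 2 ≤ (part0 r F \ partr r F).card) :
    ¬ ∃ k ∈ partner r F, ∀ p ∈ part0 r F, p ⊆ k := by
  rintro ⟨k, hk, hkp⟩
  have := card_part0_sdiff_partr_le_one_of_partner_superset hF hP hk hkp
  omega

end Tightening

end PercRepro.MSTight
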